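import Mathlib
import HarnessLib
import Literature.NumberTheory.DiophantineGeometry.RothPrelim

/-!
# Roth's theorem after Schmidt (LNM 785, Ch. V) — the combinatorial Lemma 4A and Lemma 5C

Source: W. M. Schmidt, *Diophantine Approximation*, LNM 785 (1980), Ch. V §4 (Lemma 4A,
inequality (4.3)) and §5 (Lemma 5C) [Schmidt1980].

* `Roth.card_filter_wt_le` — the one-sided count (4.3) behind **Lemma 4A**: among the integer
  points `0 ≤ i_h ≤ r_h` of a box, those with `Σ_h i_h/r_h - m/2 ≤ -εm` number at most
  `(r₁+1)⋯(r_m+1) · e^{-ε²m/4}` (Schmidt's proof via `e^x ≤ 1 + x + x²`, attributed to Reuter;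
  we allow `0 < ε ≤ 4`, which is all the argument uses). Lemma 4A itself (two-sided, factor `2`)
  is (4.3) applied twice; only the lower tail is used in the Index Theorem.
* `Roth.powerCoeffs Q ℓ k = a_k^{(ℓ)}` and **Lemma 5C**: for a monic integer polynomial
  `Q = X^d + a₁X^{d-1} + ⋯ + a_d` with root `α`, `α^ℓ = Σ_{k<d} a_k^{(ℓ)} α^k` with integers
  `|a_k^{(ℓ)}| ≤ (|Q| + 1)^ℓ` (`powerCoeffs_spec`, `abs_powerCoeffs_le`), where
  `|Q| = Roth.polyHeight Q` is the maximum of the absolute values of the coefficients.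

## References

* [Schmidt1980] W. M. Schmidt, *Diophantine Approximation*, LNM 785, Springer 1980, Ch. V,
  Lemma 4A and (4.3)–(4.7), pp. 118–120; Lemma 5C, p. 122.
-/

noncomputable section

open Real Finset Polynomial

namespace Literature.NumberTheory.DiophantineGeometry

namespace Roth

/-! ### Lemma 4A: the lower tail count (4.3) -/

/-- The one-variable estimate in the proof of (4.3) (Schmidt (4.5)–(4.7) with `n = 2`):
`Σ_{c=0}^{r} exp((ε/2)(1/2 - c/r)) ≤ (r + 1) e^{ε²/16}` for `r ≥ 1`, `0 < ε ≤ 4`, from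
`e^x ≤ 1 + x + x²` (`|x| ≤ 1`) and `Σ_c (1/2 - c/r) = 0`. [cite: Schmidt1980, Ch. V (4.5)–(4.7)] -/
theorem sum_exp_half_sub_le (r : ℕ) (hr : 0 < r) (ε : ℝ) (hε0 : 0 ≤ ε) (hε4 : ε ≤ 4) :
    ∑ c ∈ range (r + 1), exp (ε / 2 * (1 / 2 - c / r)) ≤ (r + 1) * exp (ε ^ 2 / 16) := by
  have hrR : (0 : ℝ) < r := by exact_mod_cast hr
  set x : ℕ → ℝ := fun c => ε / 2 * (1 / 2 - c / r) with hx
  have hxabs : ∀ c ∈ range (r + 1), |x c| ≤ ε / 4 := by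
    intro c hc
    have hc' : (c : ℝ) ≤ r := by exact_mod_cast Nat.lt_succ_iff.mp (mem_range.mp hc)
    have h1 : |(1 : ℝ) / 2 - c / r| ≤ 1 / 2 := by
      rw [abs_le]
      constructor
      · have : (c : ℝ) / r ≤ 1 := by rw [div_le_one hrR]; exact hc'
        linarith
      · have : (0 : ℝ) ≤ c / r := by positivity
        linarith
    rw [hx]
    dsimp only
    rw [abs_mul, abs_of_nonneg (by positivity : (0 : ℝ) ≤ ε / 2)]
    nlinarith
  have hsum0 : ∑ c ∈ range (r + 1), x c = 0 := by
    simp only [hx, ← mul_sum, sum_sub_distrib, sum_const, card_range, nsmul_eq_mul,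
      ← sum_div]
    have h2 : (∑ c ∈ range (r + 1), (c : ℝ)) = r * (r + 1) / 2 := by
      have := sum_range_id_mul_two (r + 1)
      simp only [Nat.add_sub_cancel] at this
      have h3 : ((∑ i ∈ range (r + 1), i : ℕ) : ℝ) * 2 = (r + 1 : ℕ) * r := by exact_mod_cast this
      push_cast at h3 ⊢
      linarith
    rw [h2]
    field_simp
    push_cast
    ring
  calc ∑ c ∈ range (r + 1), exp (ε / 2 * (1 / 2 - c / r))
      = ∑ c ∈ range (r + 1), exp (x c) := rfl
    _ ≤ ∑ c ∈ range (r + 1), (1 + x c + (ε / 4) ^ 2) := by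
        apply sum_le_sum
        intro c hc
        have h1 : |x c| ≤ 1 := (hxabs c hc).trans (by linarith)
        have h2 := abs_exp_sub_one_sub_id_le h1
        have h3 : (x c) ^ 2 ≤ (ε / 4) ^ 2 := by
          rw [← sq_abs (x c)]
          exact pow_le_pow_left₀ (abs_nonneg _) (hxabs c hc) 2
        linarith [(abs_le.mp h2).2]
    _ = (r + 1) + 0 + (r + 1) * (ε / 4) ^ 2 := by
        rw [sum_add_distrib, sum_add_distrib, hsum0, sum_const, sum_const, card_range]
        simp
    _ = (r + 1) * (ε ^ 2 / 16 + 1) := by ring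
    _ ≤ (r + 1) * exp (ε ^ 2 / 16) := by
        gcongr
        exact add_one_le_exp _

/-- **Lemma 4A, lower tail** (Schmidt, Ch. V, inequality (4.3) with `n = 2`): for positive
integers `r₁, …, r_m` and `0 < ε ≤ 4`, the number of integer points `(i₁, …, i_m)` with
`0 ≤ i_h ≤ r_h` and `(Σ_h i_h/r_h) - m/2 ≤ -εm` is at most `(r₁+1)⋯(r_m+1) e^{-ε²m/4}`.
(Schmidt states `0 < ε < 1`; the printed proof uses only `|εx/2| ≤ 1`.) The box is the
`Fintype.piFinset` of the ranges `{0, …, r_h}`. [cite: Schmidt1980, Ch. V Lemma 4A, (4.3)] -/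
theorem card_filter_wt_le (m : ℕ) (r : Fin m → ℕ) (hr : ∀ h, 0 < r h) (ε : ℝ) (hε0 : 0 < ε)
    (hε4 : ε ≤ 4) :
    (((Fintype.piFinset fun h => range (r h + 1)).filter
        fun i : Fin m → ℕ => (∑ h, (i h : ℝ) / r h) - m / 2 ≤ -(ε * m)).card : ℝ) ≤
      (∏ h, ((r h : ℝ) + 1)) * exp (-(ε ^ 2 * m / 4)) := by
  set box := Fintype.piFinset fun h : Fin m => range (r h + 1) with hbox
  set S := box.filter fun i : Fin m → ℕ => (∑ h, (i h : ℝ) / r h) - m / 2 ≤ -(ε * m) with hS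
  set g : Fin m → ℕ → ℝ := fun h c => exp (ε / 2 * (1 / 2 - c / r h)) with hg
  -- each point of `S` contributes at least `exp (ε² m / 2)`
  have hlow : ∀ i ∈ S, exp (ε ^ 2 * m / 2) ≤ ∏ h, g h (i h) := by
    intro i hi
    rw [hS, mem_filter] at hi
    rw [hg]
    dsimp only
    rw [← exp_sum, exp_le_exp, ← mul_sum, sum_sub_distrib, sum_const, card_univ,
      Fintype.card_fin, nsmul_eq_mul]
    have := hi.2
    nlinarith
  have hupp : ∑ i ∈ box, ∏ h, g h (i h) ≤ (∏ h, ((r h : ℝ) + 1)) * exp (ε ^ 2 * m / 16) := by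
    rw [hbox, ← prod_univ_sum]
    have h16 : exp (ε ^ 2 * m / 16) = ∏ _h : Fin m, exp (ε ^ 2 / 16) := by
      rw [prod_const, card_univ, Fintype.card_fin, ← exp_nat_mul]; ring_nf
    rw [h16, ← prod_mul_distrib]
    apply prod_le_prod
    · intro h _
      exact sum_nonneg fun c _ => (exp_pos _).le
    · intro h _
      exact sum_exp_half_sub_le (r h) (hr h) ε hε0.le hε4
  have hcard : (S.card : ℝ) * exp (ε ^ 2 * m / 2) ≤ ∑ i ∈ box, ∏ h, g h (i h) := by
    calc (S.card : ℝ) * exp (ε ^ 2 * m / 2) = ∑ i ∈ S, exp (ε ^ 2 * m / 2) := by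
          rw [sum_const, nsmul_eq_mul]
      _ ≤ ∑ i ∈ S, ∏ h, g h (i h) := sum_le_sum hlow
      _ ≤ ∑ i ∈ box, ∏ h, g h (i h) :=
          sum_le_sum_of_subset_of_nonneg (filter_subset _ _) fun i _ _ =>
            prod_nonneg fun h _ => (exp_pos _).le
  have hexp : exp (ε ^ 2 * m / 16) = exp (-(ε ^ 2 * m / 4)) * exp (ε ^ 2 * m / 2) *
      exp (-(3 * ε ^ 2 * m / 16)) := by
    rw [← exp_add, ← exp_add]; ring_nf
  have h3 : exp (-(3 * ε ^ 2 * m / 16)) ≤ 1 := by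
    rw [exp_le_one_iff]
    have : (0 : ℝ) ≤ 3 * ε ^ 2 * m / 16 := by positivity
    linarith
  have hN : (0 : ℝ) ≤ ∏ h, ((r h : ℝ) + 1) := prod_nonneg fun h _ => by positivity
  have key : (S.card : ℝ) * exp (ε ^ 2 * m / 2) ≤
      (∏ h, ((r h : ℝ) + 1)) * exp (-(ε ^ 2 * m / 4)) * exp (ε ^ 2 * m / 2) := by
    calc (S.card : ℝ) * exp (ε ^ 2 * m / 2) ≤ (∏ h, ((r h : ℝ) + 1)) * exp (ε ^ 2 * m / 16) :=
          hcard.trans hupp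
      _ = (∏ h, ((r h : ℝ) + 1)) * exp (-(ε ^ 2 * m / 4)) * exp (ε ^ 2 * m / 2) *
            exp (-(3 * ε ^ 2 * m / 16)) := by rw [hexp]; ring
      _ ≤ (∏ h, ((r h : ℝ) + 1)) * exp (-(ε ^ 2 * m / 4)) * exp (ε ^ 2 * m / 2) * 1 := by
          gcongr
      _ = _ := by ring
  exact le_of_mul_le_mul_right key (exp_pos _)

/-! ### Lemma 5C: powers of an algebraic integer -/

/-- The height `|Q|` of an integer polynomial in one variable: the maximum of the absolute values
of its coefficients (`0` for `Q = 0`). [cite: Schmidt1980, Ch. V §5] -/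
def polyHeight (Q : ℤ[X]) : ℕ :=
  Q.support.sup fun k => (Q.coeff k).natAbs

/-- Every coefficient is bounded by the height. [folklore] -/
theorem natAbs_coeff_le_polyHeight (Q : ℤ[X]) (k : ℕ) : (Q.coeff k).natAbs ≤ polyHeight Q := by
  by_cases hk : k ∈ Q.support
  · exact Finset.le_sup (f := fun k => (Q.coeff k).natAbs) hk
  · simp [Polynomial.notMem_support_iff.mp hk]

/-- Schmidt's integers `a_k^{(ℓ)}` with `α^ℓ = Σ_{k<d} a_k^{(ℓ)} α^k` for a root `α` of the monic
integer polynomial `Q` of degree `d` (Lemma 5C), defined by the recursion of the printed proof: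
`a^{(0)} = e₀` and `a_k^{(ℓ+1)} = a_{k-1}^{(ℓ)} - q_k a_{d-1}^{(ℓ)}` (`q_k` the coefficients of `Q`,
`a_{-1} := 0`), and set to `0` for `k ≥ d`. [cite: Schmidt1980, Ch. V Lemma 5C] -/
def powerCoeffs (Q : ℤ[X]) : ℕ → ℕ → ℤ
  | 0 => fun k => if k = 0 then 1 else 0
  | ℓ + 1 => fun k =>
      if k < Q.natDegree then
        (if k = 0 then 0 else powerCoeffs Q ℓ (k - 1)) - Q.coeff k * powerCoeffs Q ℓ (Q.natDegree - 1)
      else 0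

/-- `a_k^{(ℓ)} = 0` for `k ≥ d` (when `d ≥ 1`). [folklore] -/
theorem powerCoeffs_eq_zero_of_le (Q : ℤ[X]) (hd : 1 ≤ Q.natDegree) (ℓ k : ℕ)
    (hk : Q.natDegree ≤ k) : powerCoeffs Q ℓ k = 0 := by
  cases ℓ with
  | zero => simp [powerCoeffs]; omega
  | succ ℓ => simp [powerCoeffs, not_lt.mpr hk]

/-- **Lemma 5C, identity** (Schmidt, Ch. V): if `Q` is monic of degree `d ≥ 1` with integer
coefficients and `Q(α) = 0` in a commutative ring, then `α^ℓ = Σ_{k<d} a_k^{(ℓ)} α^k` for every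
`ℓ ≥ 0`. [cite: Schmidt1980, Ch. V Lemma 5C] -/
theorem powerCoeffs_spec {A : Type*} [CommRing A] (Q : ℤ[X]) (hQ : Q.Monic)
    (hd : 1 ≤ Q.natDegree) (α : A) (hα : Polynomial.aeval α Q = 0) (ℓ : ℕ) :
    α ^ ℓ = ∑ k ∈ range Q.natDegree, (powerCoeffs Q ℓ k : A) * α ^ k := by
  obtain ⟨d', hd'⟩ : ∃ d', Q.natDegree = d' + 1 := ⟨Q.natDegree - 1, by omega⟩
  -- the relation `α^d = - Σ_{k<d} q_k α^k`
  have hrel : α ^ (d' + 1) = -∑ k ∈ range (d' + 1), (Q.coeff k : A) * α ^ k := by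
    have h1 : Polynomial.aeval α Q = ∑ k ∈ range (Q.natDegree + 1), (Q.coeff k : A) * α ^ k := by
      rw [Polynomial.aeval_eq_sum_range]
      simp [Algebra.smul_def]
    have hlead : Q.coeff (d' + 1) = 1 := by rw [← hd']; exact hQ
    rw [hα, hd', sum_range_succ, hlead, Int.cast_one, one_mul] at h1
    exact eq_neg_of_add_eq_zero_right h1.symm
  rw [hd']
  induction ℓ with
  | zero =>
    rw [pow_zero, sum_range_succ']
    simp [powerCoeffs]
  | succ ℓ ih =>
    have hstep : α ^ (ℓ + 1) = ∑ k ∈ range d', (powerCoeffs Q ℓ k : A) * α ^ (k + 1) +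
        (powerCoeffs Q ℓ d' : A) * -∑ k ∈ range (d' + 1), (Q.coeff k : A) * α ^ k := by
      rw [pow_succ, ih, sum_mul, sum_range_succ, ← hrel]
      congr 1
      · exact sum_congr rfl fun k _ => by ring
      · ring
    have hrhs : ∑ k ∈ range (d' + 1), (powerCoeffs Q (ℓ + 1) k : A) * α ^ k =
        ∑ k ∈ range (d' + 1), (if k = 0 then 0 else (powerCoeffs Q ℓ (k - 1) : A)) * α ^ k -
          (powerCoeffs Q ℓ d' : A) * ∑ k ∈ range (d' + 1), (Q.coeff k : A) * α ^ k := by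
      have e : ∀ k ∈ range (d' + 1), (powerCoeffs Q (ℓ + 1) k : A) * α ^ k =
          (if k = 0 then 0 else (powerCoeffs Q ℓ (k - 1) : A)) * α ^ k -
            (powerCoeffs Q ℓ d' : A) * ((Q.coeff k : A) * α ^ k) := by
        intro k hk
        have hkd : k < Q.natDegree := by rw [hd']; exact mem_range.mp hk
        have hdm : Q.natDegree - 1 = d' := by omega
        simp only [powerCoeffs, if_pos hkd, hdm]
        split_ifs <;> push_cast <;> ring
      rw [sum_congr rfl e, sum_sub_distrib, ← mul_sum]
    have hshift : ∑ k ∈ range (d' + 1), (if k = 0 then 0 else (powerCoeffs Q ℓ (k - 1) : A)) * α ^ k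
        = ∑ k ∈ range d', (powerCoeffs Q ℓ k : A) * α ^ (k + 1) := by
      rw [sum_range_succ']
      simp
    rw [hrhs, hshift, hstep]
    ring

/-- **Lemma 5C, bound** (Schmidt, Ch. V): `|a_k^{(ℓ)}| ≤ (|Q| + 1)^ℓ`.
[cite: Schmidt1980, Ch. V Lemma 5C] -/
theorem abs_powerCoeffs_le (Q : ℤ[X]) (ℓ k : ℕ) :
    |powerCoeffs Q ℓ k| ≤ ((polyHeight Q : ℤ) + 1) ^ ℓ := by
  induction ℓ generalizing k with
  | zero => simp only [powerCoeffs, pow_zero]; split_ifs <;> simp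
  | succ ℓ ih =>
    simp only [powerCoeffs]
    have hH : ∀ j, |Q.coeff j| ≤ (polyHeight Q : ℤ) := fun j => by
      rw [Int.abs_eq_natAbs]; exact_mod_cast natAbs_coeff_le_polyHeight Q j
    have hH0 : (0 : ℤ) ≤ polyHeight Q := by positivity
    split_ifs with h1 h2
    · rw [zero_sub, abs_neg, abs_mul, pow_succ]
      calc |Q.coeff k| * |powerCoeffs Q ℓ (Q.natDegree - 1)|
          ≤ (polyHeight Q : ℤ) * ((polyHeight Q : ℤ) + 1) ^ ℓ :=
            mul_le_mul (hH k) (ih _) (abs_nonneg _) hH0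
        _ ≤ ((polyHeight Q : ℤ) + 1) ^ ℓ * ((polyHeight Q : ℤ) + 1) := by
            rw [mul_comm]; gcongr; linarith
    · rw [pow_succ]
      calc |powerCoeffs Q ℓ (k - 1) - Q.coeff k * powerCoeffs Q ℓ (Q.natDegree - 1)|
          ≤ |powerCoeffs Q ℓ (k - 1)| + |Q.coeff k * powerCoeffs Q ℓ (Q.natDegree - 1)| :=
            abs_sub _ _
        _ ≤ ((polyHeight Q : ℤ) + 1) ^ ℓ + (polyHeight Q : ℤ) * ((polyHeight Q : ℤ) + 1) ^ ℓ := by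
            rw [abs_mul]
            exact add_le_add (ih _) (mul_le_mul (hH k) (ih _) (abs_nonneg _) hH0)
        _ = ((polyHeight Q : ℤ) + 1) ^ ℓ * ((polyHeight Q : ℤ) + 1) := by ring
    · rw [abs_zero]; positivity

end Roth

end Literature.NumberTheory.DiophantineGeometry
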